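import Summits.CriticalPhenomena.CardyFormulaZ2.Theorems.CardyIKTransportIKLinearTransportWallDominationDefs

/-!
# `CardyIKTransport.IKLinearTransport` (stmt-CriticalPhenomena-5076, line `pinned-diagram-exchange`, lead c8 wave 1) —
# WALL DOMINATION: permutation invariance of slab probabilities (`stub_permInvariance : PermInvariance`)

Support file (`--supports stmt-CriticalPhenomena-5076`).  Proves the registered sub-goal `PermInvariance` of
`…WallDominationDefs`: the slab probability `cylProb w L τ E` of an event `E` that is determined off every interior
cell column given the block diagram around it (`OffColDetermined w L i hi E` for every `i` with `i + 1 < w`) is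
invariant under every permutation `σ` of the face types, `cylProb w L (τ ∘ σ) E = cylProb w L τ E`.

This is the sister line's `CylBunchStub.cylArcs_τSwap` / `CylBunchStub.cylArcs_comp_perm` (stmt-5911,
`…TransportStubCylBunch`) with the arcs event freed:
* two adjacent face types `i, i+1` of EQUAL kind: `τSwap i hi τ = τ`; of DIFFERENT kind: the landed cylinder
  exchange `stub_cylExchange : CylExchange` applied to `E` and the hypothesis `OffColDetermined w L i hi E`
  (`PermInvarianceStub.cylProb_τSwap`);
* adjacent transpositions generate the symmetric group (`Equiv.Perm.mclosure_swap_castSucc_succ`,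
  `Submonoid.closure_induction`; `PermInvarianceStub.cylProb_comp_perm`).
-/

noncomputable section

namespace Summit.CriticalPhenomena.CardyFormulaZ2.Theorems.IKLinearTransport.PinnedDiagramExchange.WallDomination

open scoped BigOperators Classical
open Finset
open Summit.CriticalPhenomena.CardyFormulaZ2.Cruxes.IKMixedBoxCrossing.DefectClosureExploration

namespace PermInvarianceStub

/-- Swapping two adjacent face types preserves the slab probability of an event determined off the cell column
between them (different kinds: the landed `stub_cylExchange`; equal kinds: the swap is the identity).
-- adapted from `CylBunchStub.cylArcs_τSwap` (…TransportStubCylBunch), arcs event freed. -/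
theorem cylProb_τSwap {w L : ℕ} [NeZero L] (hL : 3 ≤ L) (E : Set (CylCfg w L)) (τ : Fin w → Bool) (i : ℕ)
    (hi : i + 1 < w) (hE : OffColDetermined w L i hi E) : cylProb w L (τSwap i hi τ) E = cylProb w L τ E := by
  by_cases hne : τ ⟨i, by omega⟩ = τ ⟨i + 1, hi⟩
  · have hτ : τSwap i hi τ = τ := by
      funext j
      simp only [τSwap, Function.comp_apply]
      rcases eq_or_ne j ⟨i, by omega⟩ with rfl | h1
      · rw [Equiv.swap_apply_left]; exact hne.symm
      rcases eq_or_ne j ⟨i + 1, hi⟩ with rfl | h2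
      · rw [Equiv.swap_apply_right]; exact hne
      rw [Equiv.swap_apply_of_ne_of_ne h1 h2]
    rw [hτ]
  · exact (stub_cylExchange w L hL τ i hi hne E hE).symm

/-- The slab probability of an event determined off every interior cell column is invariant under every
permutation of the face types (adjacent transpositions generate the symmetric group,
`Equiv.Perm.mclosure_swap_castSucc_succ`).
-- adapted from `CylBunchStub.cylArcs_comp_perm` (…TransportStubCylBunch), arcs event freed. -/
theorem cylProb_comp_perm {w L : ℕ} [NeZero L] (hL : 3 ≤ L) (E : Set (CylCfg w L))
    (hE : ∀ (i : ℕ) (hi : i + 1 < w), OffColDetermined w L i hi E) (σ : Equiv.Perm (Fin w))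
    (τ : Fin w → Bool) : cylProb w L (τ ∘ σ) E = cylProb w L τ E := by
  cases w with
  | zero =>
    congr 1
    funext j
    exact j.elim0
  | succ m =>
    have hσ : σ ∈ Submonoid.closure (Set.range fun i : Fin m => Equiv.swap i.castSucc i.succ) := by
      rw [Equiv.Perm.mclosure_swap_castSucc_succ]; exact Submonoid.mem_top σ
    induction hσ using Submonoid.closure_induction generalizing τ with
    | mem σ hσ =>
      obtain ⟨i, rfl⟩ := hσ
      have hi : i.val + 1 < m + 1 := by have := i.isLt; omega
      have key := cylProb_τSwap hL E τ i.val hi (hE i.val hi)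
      convert key using 3
      simp only [τSwap]
      congr 2
    | one => rfl
    | mul σ σ' _ _ ih ih' => rw [Equiv.Perm.coe_mul, ← Function.comp_assoc, ih', ih]

end PermInvarianceStub

/-- **STUB · `stub_permInvariance`** (registered sub-goal of the line `pinned-diagram-exchange`, lead c8 wave 1):
`PermInvariance` — the slab probability of an event determined off every interior cell column given the block
diagram around it is invariant under every permutation of the face types. -/
theorem stub_permInvariance : PermInvariance :=
  fun _ _ _ hL E hE σ τ => PermInvarianceStub.cylProb_comp_perm hL E hE σ τ

end Summit.CriticalPhenomena.CardyFormulaZ2.Theorems.IKLinearTransport.PinnedDiagramExchange.WallDomination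

end
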